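import Summits.FinalStateConjecture.FinalStateConjecture.Theorems.EIHFluxBalanceInertialRecessionStubIdentificationCovPrep

/-!
# Route EIHFluxBalance — `InertialRecession`, line `sublinear-is-free-clean-window-charges`:
# covariance of the Landau–Lifshitz four-momentum of a STATIONARY vacuum field under linear
# changes of chart (stub `stub_identification`, part A1c)

Helper file (`--supports stmt-FinalStateConjecture-10166`) for the crux
`Summit.FinalStateConjecture.FinalStateConjecture.Theses.EIHFluxBalance.InertialRecession`.

Let `g` be stationary components (`g(x + s∂₀) = g(x)`), `C^∞`, nondegenerate and with vanishing
Landau–Lifshitz complex `Σ_α ∂_α h^{μνα} = 0` off a compact set `K` of every slice (for an exact Kerr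
black hole in Kerr–Schild coordinates all three hold, `KSFlux.emComplex_kerr_eq_zero`), and let
`g' x (v, w) = g (Lx)(Lv, Lw)` be its pull-back by a linear automorphism `L` of `E4` whose lab slices
are transverse to the rest time axis. Then for every lab coordinate sphere `{x⁰ = t, |y − ξ| = R}`
enclosing the lab trace of `K`,
`P'^μ(t; ξ, R) = |det A|⁻¹ (det P)² Q₀₀ Σ_{μ'} Q_{μμ'} P^{μ'}(0; 0, ρ)`
(`quasiLocalMomentum_linChart_static`), `P` the matrix of `L`, `Q = P⁻¹`, `A` the spatial block
of `P`, and `P^{μ'}(0; 0, ρ)` the rest-frame charge of any sphere `{|z| = ρ} ⊃ K`. Proof (no Stokes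
theorem on tilted hypersurfaces): write the lab charge as the bulk pairing `∫ ∇χ · h'^{μ0·}` with a
cutoff `χ = χ̃ ∘ A_t` pulled back from the rest frame (`quasiLocalMomentum_eq_integral_cutoff`),
transform `h'` (`hField_linChart`, a tensor density) and use stationarity to land on the rest slice
`{z⁰ = 0}`, change variables by the affine slice map `A_t` (factor `|det A|⁻¹`), contract the
derivative index (the `Q₀Q₀`-term dies by antisymmetry of `h`), and evaluate: the `ν' = 0` component
is the rest charge, the spatial components vanish (`integral_cutoff_spatial_eq_zero`). This is LL's
"`P^i` is a four-vector" (§96, after (96.17)) for stationary sources with singularities.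
[cite: LandauLifshitz1975, §96 (96.16)–(96.17)]
-/

set_option linter.dupNamespace false

noncomputable section

-- instance search on the nested operator spaces `E4 →L[ℝ] E4 →L[ℝ] ℝ` is deep
set_option maxSynthPendingDepth 3

open Set Metric Filter MeasureTheory MeasureTheory.Measure Module
open scoped Topology ContDiff RealInnerProductSpace

namespace Summit.FinalStateConjecture.FinalStateConjecture.Theorems

namespace SublinearIsFree.ChargeModel

open Literature.Geometry.Lorentzian Literature.Geometry.Lorentzian.LandauLifshitz
open Literature.Analysis.FluidPDE LLBalance LLGauss SublinearIsFree.WindowCharges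

variable {g g' : E4 → E4 →L[ℝ] E4 →L[ℝ] ℝ}

/-! ### The covariance theorem -/

/-- **Covariance of the Landau–Lifshitz four-momentum of a stationary vacuum field under linear
changes of chart.** See the module docstring: for `g` stationary, `C^∞`, nondegenerate and with
`Σ_α ∂_α h^{μνα} = 0` off the cylinder over a compact `K ⊆ E3`, and `g' x (v,w) = g (Lx)(Lv, Lw)`
(`L` a linear automorphism with lab slices transverse to the rest time axis, `g'` smooth with
`Σ_α ∂_α h'^{μ0α} = 0` off the lab trace of the cylinder), every lab sphere `{x⁰ = t, |y − ξ| = R}`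
enclosing the lab trace of `K` has
`P'^μ(t; ξ, R) = |det A|⁻¹ (det P)² Q₀₀ Σ_{μ'} Q_{μμ'} P^{μ'}(0; 0, ρ)` for every rest sphere
`{|z| = ρ} ⊃ K` (`P_{ij} = (L∂_j)^i`, `Q` the matrix of `L⁻¹`, `A_{mj} = P_{m+1,j+1}`).
[cite: LandauLifshitz1975, §96 (96.16)–(96.17)] -/
theorem quasiLocalMomentum_linChart_static (L : E4 ≃L[ℝ] E4)
    (hg' : ∀ x v w, g' x v w = g (L x) (L v) (L w)) {K : Set E3} (hK : IsCompact K)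
    (hg : ContDiffOn ℝ ∞ g {x | E4.spatial x ∉ K})
    (hdet : ∀ x, E4.spatial x ∉ K → metricDet g x ≠ 0)
    (hem : ∀ x, E4.spatial x ∉ K → ∀ μ ν, emComplex g x μ ν = 0)
    (hstat : ∀ x (s : ℝ), g (x + s • E4.basisVector 0) = g x)
    (hg'c : ContDiffOn ℝ ∞ g' {x | E4.spatial (L x) ∉ K})
    (hem' : ∀ x, E4.spatial (L x) ∉ K → ∀ μ, emComplex g' x μ 0 = 0)
    (hinj : Function.Injective fun y : E3 ↦ E4.spatial (L (E4.ofTimeSpace 0 y)))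
    {t : ℝ} {ξ : E3} {R : ℝ} (hR : 0 < R)
    (hKin : ∀ y, E4.spatial (L (E4.ofTimeSpace t y)) ∈ K → y ∈ ball ξ R)
    {ρ : ℝ} (hρ : 0 < ρ) (hρK : K ⊆ ball 0 ρ) (μ : Fin 4) :
    quasiLocalMomentum g' t ξ R μ =
      |(Matrix.of fun m j : Fin 3 ↦ (L (E4.basisVector j.succ)) m.succ).det|⁻¹ *
        ((Matrix.of fun i j : Fin 4 ↦ ((L : E4 →L[ℝ] E4) (E4.basisVector j)) i).det ^ 2 *
          ((Matrix.of fun i j : Fin 4 ↦ ((L.symm : E4 →L[ℝ] E4) (E4.basisVector j)) i) 0 0 *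
            ∑ μ' : Fin 4, (Matrix.of fun i j : Fin 4 ↦ ((L.symm : E4 →L[ℝ] E4) (E4.basisVector j)) i)
              μ μ' * quasiLocalMomentum g 0 0 ρ μ')) := by
  -- the matrices of `L`, `L⁻¹`
  set P : Matrix (Fin 4) (Fin 4) ℝ :=
    Matrix.of fun i j : Fin 4 ↦ ((L : E4 →L[ℝ] E4) (E4.basisVector j)) i with hP
  set Q : Matrix (Fin 4) (Fin 4) ℝ :=
    Matrix.of fun i j : Fin 4 ↦ ((L.symm : E4 →L[ℝ] E4) (E4.basisVector j)) i with hQ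
  have hPQ : P * Q = 1 := linChartMatrix_mul_symm L
  have hDP : P.det ≠ 0 := det_linChartMatrix_ne_zero L
  -- the regular sets
  set W : Set E4 := {x | E4.spatial x ∉ K} with hW
  have hWo : IsOpen W := hK.isClosed.isOpen_compl.preimage E4.spatial.continuous
  set W' : Set E4 := {x | E4.spatial (L x) ∉ K} with hW'
  have hW'o : IsOpen W' :=
    hK.isClosed.isOpen_compl.preimage (E4.spatial.continuous.comp L.continuous)
  have hdetW : ∀ x ∈ W, metricDet g x ≠ 0 := fun x hx ↦ hdet x hx
  have hdet' : ∀ x ∈ W', metricDet g' x ≠ 0 := fun x hx ↦ by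
    rw [show metricDet g' x = P.det ^ 2 * metricDet g (L x) from
      metricDet_linChart (L : E4 →L[ℝ] E4) hg' x]
    exact mul_ne_zero (pow_ne_zero 2 hDP) (hdet _ hx)
  -- the spatial block as an automorphism of `E3`, and the affine slice map `y ↦ a + Ae y`
  obtain ⟨S, hS⟩ := exists_clm_ofTimeSpace_zero
  set Acl : E3 →L[ℝ] E3 := E4.spatial.comp ((L : E4 →L[ℝ] E4).comp S) with hAcl
  have hAcl_apply : ∀ y, Acl y = E4.spatial (L (E4.ofTimeSpace 0 y)) := fun y ↦ by
    simp only [hAcl, ContinuousLinearMap.comp_apply, hS, ContinuousLinearEquiv.coe_coe]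
  have hAinj : Function.Injective (Acl : E3 →ₗ[ℝ] E3) := fun y y' h ↦
    hinj (by simpa only [ContinuousLinearMap.coe_coe, hAcl_apply] using h)
  set Ae : E3 ≃L[ℝ] E3 :=
    (LinearEquiv.ofInjectiveEndo (Acl : E3 →ₗ[ℝ] E3) hAinj).toContinuousLinearEquiv with hAe
  have hAe_apply : ∀ y, Ae y = E4.spatial (L (E4.ofTimeSpace 0 y)) := fun y ↦ by
    rw [← hAcl_apply]
    rfl
  have hAe_single : ∀ j m : Fin 3, (Ae (EuclideanSpace.single j (1 : ℝ))) m = P m.succ j.succ := by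
    intro j m
    rw [hAe_apply, E4.spatial_apply, ofTimeSpace_zero_single, hP, Matrix.of_apply]
    rfl
  set a : E3 := E4.spatial (L ((t : ℝ) • E4.basisVector 0)) with ha
  have hAt : ∀ y, E4.spatial (L (E4.ofTimeSpace t y)) = a + Ae y := fun y ↦ by
    rw [ofTimeSpace_eq_smul_add_ofTimeSpace_zero, map_add, map_add, hAe_apply]
  have hdetA : LinearMap.det (Ae.toLinearEquiv : E3 →ₗ[ℝ] E3) =
      (Matrix.of fun m j : Fin 3 ↦ (L (E4.basisVector j.succ)) m.succ).det := by
    rw [det_eq_det_matrix_of]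
    congr 1
    ext m j
    rw [Matrix.of_apply, Matrix.of_apply]
    exact hAe_single j m
  have hAtc : ContDiff ℝ ∞ (fun y ↦ a + Ae y) := contDiff_const.add Ae.contDiff
  -- the rest-frame cutoff `χr = 1 − Ψ`, `Ψ` a plateau of `K` inside `ball 0 ρ ∩ A_t(ball ξ R)`
  set Ur : Set E3 := ball 0 ρ ∩ {w | Ae.symm (w - a) ∈ ball ξ R} with hUr
  have hUro : IsOpen Ur :=
    isOpen_ball.inter (isOpen_ball.preimage (Ae.symm.continuous.comp (continuous_id.sub
      continuous_const)))
  have hKUr : K ⊆ Ur := by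
    intro w hw
    refine ⟨hρK hw, hKin _ ?_⟩
    rw [hAt, ContinuousLinearEquiv.apply_symm_apply, add_sub_cancel]
    exact hw
  obtain ⟨Ψ, hΨ, hΨ1, hΨsupp⟩ := exists_smooth_plateau hK hUro hKUr
  set χr : E3 → ℝ := fun w ↦ 1 - Ψ w with hχr_def
  have hχr : ContDiff ℝ ∞ χr := contDiff_const.sub hΨ
  have hχr0 : ∀ w ∈ K, χr =ᶠ[𝓝 w] fun _ ↦ 0 := fun w hw ↦ by
    filter_upwards [hΨ1 w hw] with z hz
    show 1 - Ψ z = 0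
    rw [hz, sub_self]
  have hχr1 : ∀ w ∉ Ur, χr =ᶠ[𝓝 w] fun _ ↦ 1 := fun w hw ↦ by
    filter_upwards [notMem_tsupport_iff_eventuallyEq.1 fun h ↦ hw (hΨsupp h)] with z hz
    show 1 - Ψ z = 1
    rw [hz, Pi.zero_apply, sub_zero]
  have hχr1' : ∀ w ∉ ball (0 : E3) ρ, χr =ᶠ[𝓝 w] fun _ ↦ 1 := fun w hw ↦ hχr1 w fun h ↦ hw h.1
  -- the lab cutoff `χ = χr ∘ A_t`
  set χ : E3 → ℝ := fun y ↦ χr (a + Ae y) with hχ_def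
  have hχ : ContDiff ℝ ∞ χ := hχr.comp hAtc
  set Kl : Set E3 := {y | E4.spatial (L (E4.ofTimeSpace t y)) ∈ K} with hKl
  have hχ0 : ∀ y ∈ Kl, χ =ᶠ[𝓝 y] fun _ ↦ 0 := fun y hy ↦ by
    have hy' : a + Ae y ∈ K := by
      rw [← hAt]
      exact hy
    exact (hAtc.continuous.tendsto y).eventually (hχr0 _ hy')
  have hχ1 : ∀ y ∉ ball ξ R, χ =ᶠ[𝓝 y] fun _ ↦ 1 := fun y hy ↦ by
    have hAty : a + Ae y ∉ Ur := fun h ↦ hy (by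
      have h2 := h.2
      rwa [mem_setOf_eq, add_sub_cancel_left, ContinuousLinearEquiv.symm_apply_apply] at h2)
    exact (hAtc.continuous.tendsto y).eventually (hχr1 _ hAty)
  -- Step 1: the lab charge as the bulk pairing with `∇χ`
  rw [quasiLocalMomentum_eq_integral_cutoff hW'o hg'c hdet' (fun x hx ↦ hem' x hx μ)
    (fun y (hy : y ∉ Kl) ↦ hy) hχ hχ0 hR hχ1]
  -- Step 2: the integrand is `J ∘ A_t` for the rest-frame density `J`
  set φr : Fin 3 → E3 → ℝ := fun m w ↦ fderiv ℝ χr w (EuclideanSpace.single m (1 : ℝ)) with hφr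
  set k : Fin 4 → Fin 4 → E3 → ℝ := fun μ' ν' w ↦
    ∑ m : Fin 3, φr m w * hField g (E4.ofTimeSpace 0 w) μ' ν' m.succ with hk
  set J : E3 → ℝ := fun w ↦ ∑ j : Fin 3, (∑ m : Fin 3, P m.succ j.succ * φr m w) *
    (P.det ^ 2 * ∑ μ' : Fin 4, ∑ ν' : Fin 4, ∑ α' : Fin 4,
      Q μ μ' * Q 0 ν' * Q j.succ α' * hField g (E4.ofTimeSpace 0 w) μ' ν' α') with hJ
  -- chain rule for the lab cutoff
  have hdχ : ∀ y (j : Fin 3), fderiv ℝ χ y (EuclideanSpace.single j (1 : ℝ)) =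
      ∑ m : Fin 3, P m.succ j.succ * φr m (a + Ae y) := by
    intro y j
    have h : HasFDerivAt χ ((fderiv ℝ χr (a + Ae y)).comp (Ae : E3 →L[ℝ] E3)) y :=
      ((hχr.differentiable (by simp)) _).hasFDerivAt.comp y
        ((Ae : E3 →L[ℝ] E3).hasFDerivAt.const_add a)
    rw [h.fderiv, ContinuousLinearMap.comp_apply, ContinuousLinearEquiv.coe_coe]
    have hexp : Ae (EuclideanSpace.single j (1 : ℝ)) =
        ∑ m : Fin 3, P m.succ j.succ • (EuclideanSpace.single m (1 : ℝ) : E3) := by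
      conv_lhs => rw [← (EuclideanSpace.basisFun (Fin 3) ℝ).sum_repr
        (Ae (EuclideanSpace.single j (1 : ℝ)))]
      simp only [EuclideanSpace.basisFun_repr, EuclideanSpace.basisFun_apply, hAe_single]
    rw [hexp, _root_.map_sum]
    simp only [map_smul, smul_eq_mul, hφr]
  have hφr0K : ∀ w ∈ K, ∀ m, φr m w = 0 := fun w hw m ↦
    fderiv_apply_eq_zero_of_eventuallyEq (hχr0 w hw) _
  have hlin : ∀ y ∉ Kl, ∀ j : Fin 3, hField g' (E4.ofTimeSpace t y) μ 0 j.succ =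
      P.det ^ 2 * ∑ μ' : Fin 4, ∑ ν' : Fin 4, ∑ α' : Fin 4,
        Q μ μ' * Q 0 ν' * Q j.succ α' * hField g (E4.ofTimeSpace 0 (a + Ae y)) μ' ν' α' := by
    intro y hy j
    have hx : L (E4.ofTimeSpace t y) ∈ W := hy
    have hH : ∀ i α ν β, DifferentiableAt ℝ (fun z ↦ superpotential g z i α ν β)
        (L (E4.ofTimeSpace t y)) := fun i α ν β ↦
      ((contDiffOn_superpotential hg hdetW i α ν β).contDiffAt (hWo.mem_nhds hx)).differentiableAt
        (by simp)
    rw [hField_linChart L hg' hH μ 0 j.succ]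
    simp only [hField_eq_hField_slice_zero hstat (L (E4.ofTimeSpace t y)), hAt y]
    rfl
  have hintegrand : ∀ y, ∑ j : Fin 3, fderiv ℝ χ y (EuclideanSpace.single j (1 : ℝ)) *
      hField g' (E4.ofTimeSpace t y) μ 0 j.succ = J (a + Ae y) := by
    intro y
    by_cases hy : y ∈ Kl
    · have hy' : a + Ae y ∈ K := by
        rw [← hAt]
        exact hy
      have hL : ∀ j : Fin 3, fderiv ℝ χ y (EuclideanSpace.single j (1 : ℝ)) = 0 := fun j ↦
        fderiv_apply_eq_zero_of_eventuallyEq (hχ0 y hy) _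
      simp only [hL, zero_mul, Finset.sum_const_zero, hJ, hφr0K _ hy', mul_zero]
    · rw [hJ]
      exact Finset.sum_congr rfl fun j _ ↦ by rw [hdχ y j, hlin y hy j]
  simp only [hintegrand]
  rw [integral_comp_affineEquiv_E3 Ae a J, hdetA]
  -- Step 3: contract the derivative index: `J = (det P)² Σ Q_{μμ'} Q_{0ν'} k^{μ'ν'}`
  have hJk : ∀ w, J w = P.det ^ 2 * ∑ μ' : Fin 4, ∑ ν' : Fin 4, Q μ μ' * Q 0 ν' * k μ' ν' w := by
    intro w
    have hT : ∀ μ', ∀ b c : Fin 4, hField g (E4.ofTimeSpace 0 w) μ' b c =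
        -hField g (E4.ofTimeSpace 0 w) μ' c b := fun μ' b c ↦ hField_swap g _ μ' c b
    calc
      J w = ∑ m : Fin 3, ∑ μ' : Fin 4, (φr m w * (P.det ^ 2 * Q μ μ')) *
          ∑ j : Fin 3, ∑ ν' : Fin 4, ∑ α' : Fin 4, P m.succ j.succ * Q 0 ν' * Q j.succ α' *
            hField g (E4.ofTimeSpace 0 w) μ' ν' α' := by
        rw [hJ]
        simp only [Finset.sum_mul]
        rw [Finset.sum_comm]
        simp only [Finset.mul_sum]
        refine Finset.sum_congr rfl fun m _ ↦ ?_
        rw [Finset.sum_comm]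
        refine Finset.sum_congr rfl fun μ' _ ↦ Finset.sum_congr rfl fun j _ ↦
          Finset.sum_congr rfl fun ν' _ ↦ Finset.sum_congr rfl fun α' _ ↦ ?_
        ring
      _ = ∑ m : Fin 3, ∑ μ' : Fin 4, (φr m w * (P.det ^ 2 * Q μ μ')) *
          ∑ ν' : Fin 4, Q 0 ν' * hField g (E4.ofTimeSpace 0 w) μ' ν' m.succ := by
        refine Finset.sum_congr rfl fun m _ ↦ Finset.sum_congr rfl fun μ' _ ↦ ?_
        rw [sum_spatialBlock_contract hPQ (hT μ') m]
      _ = P.det ^ 2 * ∑ μ' : Fin 4, ∑ ν' : Fin 4, Q μ μ' * Q 0 ν' * k μ' ν' w := by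
        simp only [hk, Finset.mul_sum]
        rw [Finset.sum_comm]
        refine Finset.sum_congr rfl fun μ' _ ↦ ?_
        rw [Finset.sum_comm]
        refine Finset.sum_congr rfl fun ν' _ ↦ Finset.sum_congr rfl fun m _ ↦ ?_
        ring
  -- Step 4: the rest-frame integrals
  set U0 : Set E3 := {w | E4.ofTimeSpace 0 w ∈ W} with hU0
  have hU0o : IsOpen U0 := hWo.preimage (E4.continuous_ofTimeSpace 0)
  have hKW0 : ∀ w ∉ K, E4.ofTimeSpace 0 w ∈ W := fun w hw ↦ by
    show E4.spatial (E4.ofTimeSpace 0 w) ∉ K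
    rwa [E4.spatial_ofTimeSpace]
  have hφrs : ∀ m, ContDiff ℝ ∞ (φr m) := fun m ↦
    (hχr.fderiv_right (by simp)).clm_apply contDiff_const
  have hslice0 : ContDiff ℝ ∞ (E4.ofTimeSpace 0) := by
    simpa only [zero_add] using contDiff_slice (n := ∞) (0 : ℝ) (0 : E3)
  have hkc : ∀ μ' ν', Continuous (k μ' ν') := by
    intro μ' ν'
    refine (contDiff_of_eventuallyEq_zero (n := ∞) (K := K) (fun w hw ↦ ?_) (fun w hw ↦ ?_)).continuous
    · exact ContDiffAt.sum fun m _ ↦ (hφrs m).contDiffAt.mul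
        ((((contDiffOn_hField hWo hg hdetW μ' ν' m.succ).comp hslice0.contDiffOn
          (fun w hw ↦ hw)).contDiffAt (hU0o.mem_nhds (hKW0 w hw))))
    · filter_upwards [eventually_all.2 fun m ↦ fderiv_apply_eventuallyEq_zero (hχr0 w hw)
        (EuclideanSpace.single m (1 : ℝ))] with z hz
      exact Finset.sum_eq_zero fun m _ ↦ by rw [show φr m z = 0 from hz m, zero_mul]
  have hk0 : ∀ μ' ν', ∀ w ∉ ball (0 : E3) ρ, k μ' ν' w = 0 := fun μ' ν' w hw ↦
    Finset.sum_eq_zero fun m _ ↦ by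
      rw [show φr m w = 0 from fderiv_apply_eq_zero_of_eventuallyEq (hχr1' w hw) _, zero_mul]
  have hki : ∀ μ' ν', Integrable (k μ' ν') := fun μ' ν' ↦
    (hkc μ' ν').integrable_of_hasCompactSupport (HasCompactSupport.of_support_subset_isCompact
      (isCompact_closedBall 0 ρ) fun w hw ↦ by
        by_contra h
        exact hw (hk0 μ' ν' w fun h' ↦ h (ball_subset_closedBall h')))
  have hI0 : ∀ μ', ∫ w, k μ' 0 w = quasiLocalMomentum g 0 0 ρ μ' := fun μ' ↦
    (quasiLocalMomentum_eq_integral_cutoff hWo hg hdetW (fun x hx ↦ hem x hx μ' 0) hKW0 hχr hχr0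
      hρ hχr1').symm
  have hIs : ∀ μ' (n : Fin 3), ∫ w, k μ' n.succ w = 0 := fun μ' n ↦
    integral_cutoff_spatial_eq_zero hWo hg hdetW (fun x hx m ↦ hem x hx μ' m.succ)
      (fun x hx m ↦ partialDeriv_zero_hField_eq_zero hstat
        (((contDiffOn_hField hWo hg hdetW μ' m.succ 0).contDiffAt (hWo.mem_nhds hx)).differentiableAt
          (by simp))) hKW0 hχr hχr0 hρ hχr1' n
  -- Step 5: assemble
  simp only [hJk]
  rw [integral_const_mul, integral_finsetSum _ fun μ' _ ↦ integrable_finsetSum _ fun ν' _ ↦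
    (hki μ' ν').const_mul _]
  congr 2
  rw [Finset.mul_sum]
  refine Finset.sum_congr rfl fun μ' _ ↦ ?_
  rw [integral_finsetSum _ fun ν' _ ↦ (hki μ' ν').const_mul _, Fin.sum_univ_succ]
  simp only [integral_const_mul, hI0, hIs, mul_zero, Finset.sum_const_zero, add_zero]
  ring

end SublinearIsFree.ChargeModel

/-- Registered sub-goal form (stub `ll_quasiLocalMomentum_linearChart_stationary` of the crux item) of
`SublinearIsFree.ChargeModel.quasiLocalMomentum_linChart_static`: covariance of the Landau–Lifshitz
four-momentum of a stationary vacuum field under linear changes of chart.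
[cite: LandauLifshitz1975, §96 (96.16)–(96.17)] -/
theorem ll_quasiLocalMomentum_linearChart_stationary : open Literature.Geometry.Lorentzian Metric in ∀ (g g' : E4 → E4 →L[ℝ] E4 →L[ℝ] ℝ) (L : E4 ≃L[ℝ] E4), (∀ x v w : E4, g' x v w = g (L x) (L v) (L w)) → ∀ (K : Set E3), IsCompact K → ContDiffOn ℝ ((⊤ : ℕ∞) : WithTop ℕ∞) g {x : E4 | E4.spatial x ∉ K} → (∀ x : E4, E4.spatial x ∉ K → LandauLifshitz.metricDet g x ≠ 0) → (∀ x : E4, E4.spatial x ∉ K → ∀ μ ν : Fin 4, LandauLifshitz.emComplex g x μ ν = 0) → (∀ (x : E4) (s : ℝ), g (x + s • E4.basisVector 0) = g x) → ContDiffOn ℝ ((⊤ : ℕ∞) : WithTop ℕ∞) g' {x : E4 | E4.spatial (L x) ∉ K} → (∀ x : E4, E4.spatial (L x) ∉ K → ∀ μ : Fin 4, LandauLifshitz.emComplex g' x μ 0 = 0) → Function.Injective (fun y : E3 ↦ E4.spatial (L (E4.ofTimeSpace 0 y))) → ∀ (t : ℝ) (ξ : E3) (R : ℝ), 0 < R →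 (∀ y : E3, E4.spatial (L (E4.ofTimeSpace t y)) ∈ K → y ∈ ball ξ R) → ∀ (ρ : ℝ), 0 < ρ → K ⊆ ball 0 ρ → ∀ μ : Fin 4, LandauLifshitz.quasiLocalMomentum g' t ξ R μ = |(Matrix.of fun m j : Fin 3 ↦ (L (E4.basisVector j.succ)) m.succ).det|⁻¹ * ((Matrix.of fun i j : Fin 4 ↦ ((L : E4 →L[ℝ] E4) (E4.basisVector j)) i).det ^ 2 * ((Matrix.of fun i j : Fin 4 ↦ ((L.symm : E4 →L[ℝ] E4) (E4.basisVector j)) i) 0 0 * ∑ μ' : Fin 4, (Matrix.of fun i j : Fin 4 ↦ ((L.symm : E4 →L[ℝ] E4) (E4.basisVector j)) i) μ μ' * LandauLifshitz.quasiLocalMomentum g 0 0 ρ μ')) :=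
  fun _g _g' L hg' _K hK hg hdet hem hstat hg'c hem' hinj _t _ξ _R hR hKin _ρ hρ hρK μ ↦
    SublinearIsFree.ChargeModel.quasiLocalMomentum_linChart_static L hg' hK hg hdet hem hstat hg'c hem'
      hinj hR hKin hρ hρK μ

end Summit.FinalStateConjecture.FinalStateConjecture.Theorems

end
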